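import Summits.RiemannHypothesis.RiemannHypothesis.Theorems.WeilFormatCCinfRowCollected
import Summits.RiemannHypothesis.RiemannHypothesis.Theorems.WeilFormatCCinfImageCollectedEven
import Summits.RiemannHypothesis.RiemannHypothesis.Theorems.WeilFormatCCinfVTable
import Summits.RiemannHypothesis.RiemannHypothesis.Theorems.WeilFormatCCinfGramHankel
import Summits.RiemannHypothesis.RiemannHypothesis.Theorems.WeilFormatCCinfWeights
import Summits.RiemannHypothesis.RiemannHypothesis.Theorems.WeilFormatCCinfRemainders
import HarnessLib

/-!
# Format C, design C∞: the EVEN sector's analytic facts PACKAGED at given orders (rescaled families) — the rung's `obtain`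

Route context: Fourier–Galerkin / Schur-complement certificates of Weil positivity on a window ("format C", C∞ door;
cell memo `run/shared/lean/pub/rh-explicit/rh-explicit-weil-10/KERNEL-LEVER.md` §22; supporting stmt-RiemannHypothesis-0098;
seat rh-explicit-weil-10).  The doors `weilPositivityOn_of_cinf_{poly,matrix,cert,table}` take the collected analytic facts
`hρrowe hrowe hρimge himge hVe hWe` for SOME family `φe`, coefficient functions `Prowe Pimge Rtabe`, remainders `ρrowe ρimge`
and weight `we`.  This file proves them ONCE, for the rescaled (tag, power `1…D`) families of weil-2's
`WeilFormatCCinfGramHankel` (`φ_(t,e)(m) = T_t(m)·(m₀/m)^{e+1}`), from the §21 family lemmas (`abs_evenRow_sub_family_le`,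
`abs_re_image_pow_sub_family_le`, `evenVTable_family`), `cinf_collected_rescale(_eq)`, `sum_Ico_weight_sq_le` and the
remainder-sign lemmas — at arbitrary expansion orders `(ν, K, R, J, J', E, D)` subject to the printed side conditions.  A rung
`obtain`s the six facts and passes the functions to the door as `_` (they are inferred from these statements).

* `cinf_facts_even`.

Assembly only; standard axioms; no definitions; no RH claim.
-/

set_option autoImplicit false
-- `Summit.RiemannHypothesis.RiemannHypothesis.…` is the layout-mandated namespace (summit = problem name).
set_option linter.dupNamespace false

noncomputable section

open Complex Filter Set MeasureTheory Finset
open scoped Real Topology ComplexConjugate ArithmeticFunction.vonMangoldt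

namespace Summit.RiemannHypothesis.RiemannHypothesis.Theorems.WeilFormatC

open Literature.NumberTheory.LFunctions Literature.NumberTheory.LFunctions.Yoshida1992
  Literature.Analysis.SpecialFunctions

variable {a : ℝ}

set_option maxHeartbeats 400000 in
/-- **The even sector's analytic facts at orders `(ν,K,R,J,J',E,D)`** for the rescaled families over `Fin 4 × Fin D`:
`(∀ n, 0 ≤ ρrowe n) ∧ hrowe ∧ (∀ q, 0 ≤ ρimge q) ∧ himge ∧ hVe ∧ hWe` in EXACTLY the hypothesis shapes of the C∞ doors, with
`φe`, `Prowe`, `ρrowe`, `Pimge`, `ρimge`, `Rtabe`, `we` the explicit functions printed below (pass them to the door as `_`). -/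
theorem cinf_facts_even (ha : 0 < a) {Be re m₀ : ℕ} (hm₀ : 2 ≤ π * m₀ / a) (hB2 : 2 * Be ≤ m₀) (hm₀2 : 2 ≤ m₀)
    (se : Finset ℕ) (coefe : Fin re → ℕ → ℝ)
    {ν : ℕ} (hν : ν ≠ 0) {K : ℕ} (hK : 2 * ν ≤ K) {R J J' E D : ℕ} (hE1 : E + 1 ≤ 2 * ν)
    (hE2 : E ≤ K) (hE3 : E ≤ 2 * R) (hEJ : E ≤ 2 * J) (hD1 : K + 2 * J ≤ D + 1) (hD2 : 2 * R + 2 * J ≤ D + 2)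
    (hEJ' : E + 1 ≤ 2 * J' + 2) (hDJ' : 2 * J' + 2 ≤ D) (hDK : ∀ q ∈ se, q + 1 + K ≤ D) (hDR : ∀ q ∈ se, q + 2 * R + 2 ≤ D)
    (hDq : ∀ q ∈ se, q + 1 ≤ D) :
    -- hρrowe
    (∀ n : ℕ, 0 ≤ (fun n : ℕ ↦ (((4 * Real.pi ^ 2 / 3 * ((2 * ν + 1).factorial : ℝ) / (2 * Real.pi) ^ (2 * ν + 1)
                * (4 * (1 / (4 * (π * m₀ / a / 2)))) ^ (2 * ν)
              + (1 / (4 * (π * m₀ / a / 2))) ^ (K + 1) / ((K + 1) * (1 - 1 / (4 * (π * m₀ / a / 2))))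
              + 2 * (1 / (4 * (π * m₀ / a / 2))) ^ (K + 1)
              + ∑ k ∈ Finset.Icc 1 ν, |(bernoulli (2 * k) : ℝ) / (2 * k)| * 2 ^ (K + 1 + 4 * k)
                  * (1 / (4 * (π * m₀ / a / 2))) ^ (K + 1)) / 2
            + (∑' k : ℕ, Real.exp (-(2 * a * digammaNode k)) * digammaNode k ^ (2 * R))
                / |π * m₀ / a| ^ (2 * R + 1)) / π
            * ∑ j ∈ Finset.range J, (n : ℝ) ^ (2 * j) / (m₀ : ℝ) ^ (2 * j + 1)
          + (2 * (π / 4 + (∑ k ∈ weilPrimeIndex a, (Λ k : ℝ) / Real.sqrt k) + a * (1 + weilArchDensity (2 * a)) / π)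
                * (n : ℝ) ^ (2 * J) / π
              + 4 / a * (Real.exp (a / 2) - Real.exp (-(a / 2))) ^ 2 * (a ^ 2 / (4 * π ^ 2)) ^ (J + 1)
                * (1 / (1 + 4 * freq a n ^ 2))) / (m₀ : ℝ) ^ (2 * J + 1))) n)
    ∧ -- hrowe
    (∀ m, m₀ ≤ m → ∀ n, n ≤ Be →
      |(if n = 0 then gramCoeff a 0 m else if m = 0 then gramCoeff a n 0
          else (gramCoeff a n m + gramCoeff a n (-(m : ℤ))) / 2)
        - (-1 : ℝ) ^ m * ∑ f : Fin 4 × Fin D, (fun (n : ℕ) (x : Fin 4 × Fin D) ↦ ((![fun d : ℕ ↦ (∑ j ∈ (Finset.range J).filter (fun j ↦ (2 * j + 1) = d),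
                π / 4 * ((-1 : ℝ) ^ n * (n : ℝ) ^ (2 * j)) / Real.pi)
              + (∑ p ∈ (Finset.Icc 1 K ×ˢ Finset.range J).filter (fun p ↦ p.1 + (2 * p.2 + 1) = d),
                  (fun N : ℕ ↦ (if N % 4 = 1 then (1 : ℝ) else if N % 4 = 3 then -1 else 0)
              * (1 - 1 / (2 * (N : ℝ))
                  - (∑ l ∈ Finset.Icc 1 ν, (bernoulli (2 * l) : ℝ) / (2 * l) * 16 ^ l
                      * (((N - 1).choose (2 * l - 1) : ℕ) : ℝ)) / 2)
              * (a / (2 * π)) ^ N) p.1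
                    * ((-1 : ℝ) ^ n * (n : ℝ) ^ (2 * p.2)) / Real.pi)
              - (∑ p ∈ (Finset.range R ×ˢ Finset.range J).filter (fun p ↦ (2 * p.1 + 1) + (2 * p.2 + 1) = d),
                  (fun r : ℕ ↦ (-1 : ℝ) ^ r *
              (∑' l : ℕ, Real.exp (-(2 * a * digammaNode l)) * digammaNode l ^ (2 * r)) * (a / π) ^ (2 * r + 1)) p.1
                    * ((-1 : ℝ) ^ n * (n : ℝ) ^ (2 * p.2)) / Real.pi)
              + (∑ r ∈ (Finset.range J).filter (fun r ↦ (2 * r + 2) = d),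
                  (fun r : ℕ ↦ (-1 : ℝ) ^ n *
              (-((n : ℝ) ^ (2 * r + 1)) * ((Complex.digamma (1 / 4 + ((freq a n : ℝ) : ℂ) / 2 * I)).im / 2
                  + (∑ k ∈ weilPrimeIndex a, (Λ k : ℝ) / Real.sqrt k * Real.sin (freq a n * Real.log k))
                  - archExpSumSin a n) / π
                + 4 / a * (Real.exp (a / 2) - Real.exp (-(a / 2))) ^ 2 * (-1 : ℝ) ^ r * (a ^ 2 / (4 * π ^ 2)) ^ (r + 1)
                  * (1 / (1 + 4 * freq a n ^ 2)))) r),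
                fun _ ↦ 0, fun _ ↦ 0,
                fun d : ℕ ↦ ∑ j ∈ (Finset.range J).filter (fun j ↦ (2 * j + 1) = d),
                ((-1 : ℝ) ^ n * (n : ℝ) ^ (2 * j)) / Real.pi] x.1) ((x.2 : ℕ) + 1) / (m₀ : ℝ) ^ ((x.2 : ℕ) + 1))) n f
            * (fun (x : Fin 4 × Fin D) (m : ℕ) ↦ ![(1 : ℝ), Real.log m, -(∑ n ∈ weilPrimeIndex a, (Λ n : ℝ) / Real.sqrt n * Real.cos (π * m / a * Real.log n)), (∑ n ∈ weilPrimeIndex a, (Λ n : ℝ) / Real.sqrt n * Real.sin (π * m / a * Real.log n))] x.1 * ((m₀ : ℝ) / (m : ℝ)) ^ ((x.2 : ℕ) + 1)) f m|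
        ≤ (fun n : ℕ ↦ (((4 * Real.pi ^ 2 / 3 * ((2 * ν + 1).factorial : ℝ) / (2 * Real.pi) ^ (2 * ν + 1)
                * (4 * (1 / (4 * (π * m₀ / a / 2)))) ^ (2 * ν)
              + (1 / (4 * (π * m₀ / a / 2))) ^ (K + 1) / ((K + 1) * (1 - 1 / (4 * (π * m₀ / a / 2))))
              + 2 * (1 / (4 * (π * m₀ / a / 2))) ^ (K + 1)
              + ∑ k ∈ Finset.Icc 1 ν, |(bernoulli (2 * k) : ℝ) / (2 * k)| * 2 ^ (K + 1 + 4 * k)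
                  * (1 / (4 * (π * m₀ / a / 2))) ^ (K + 1)) / 2
            + (∑' k : ℕ, Real.exp (-(2 * a * digammaNode k)) * digammaNode k ^ (2 * R))
                / |π * m₀ / a| ^ (2 * R + 1)) / π
            * ∑ j ∈ Finset.range J, (n : ℝ) ^ (2 * j) / (m₀ : ℝ) ^ (2 * j + 1)
          + (2 * (π / 4 + (∑ k ∈ weilPrimeIndex a, (Λ k : ℝ) / Real.sqrt k) + a * (1 + weilArchDensity (2 * a)) / π)
                * (n : ℝ) ^ (2 * J) / π
              + 4 / a * (Real.exp (a / 2) - Real.exp (-(a / 2))) ^ 2 * (a ^ 2 / (4 * π ^ 2)) ^ (J + 1)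
                * (1 / (1 + 4 * freq a n ^ 2))) / (m₀ : ℝ) ^ (2 * J + 1))) n * (fun m : ℕ ↦ ((m₀ : ℝ) / m) ^ (E + 1)) m)
    ∧ -- hρimge
    (∀ q : ℕ, 0 ≤ (fun q : ℕ ↦ (1 / Real.sqrt (2 * a)) * ( |(4 * (∫ x in (-a)..a, x ^ q * Real.cosh (x / 2)) * (Real.exp (a / 2) - Real.exp (-(a / 2))))|
              * ((a ^ 2 / (4 * π ^ 2)) ^ (J' + 1) / (m₀ : ℝ) ^ (2 * J' + 2))
            + ∑ k ∈ Finset.range (q + 1), (q.descFactorial k : ℝ) * (a / (π * m₀)) ^ (k + 1) *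
                ( |(a ^ (q - k) - (-a) ^ (q - k)) * (I ^ (k + 1)).re| *
                    ((4 * Real.pi ^ 2 / 3 * ((2 * ν + 1).factorial : ℝ) / (2 * Real.pi) ^ (2 * ν + 1)
                      * (4 * (1 / (4 * (π * m₀ / a / 2)))) ^ (2 * ν)
                    + (1 / (4 * (π * m₀ / a / 2))) ^ (K + 1) / ((K + 1) * (1 - 1 / (4 * (π * m₀ / a / 2))))
                    + 2 * (1 / (4 * (π * m₀ / a / 2))) ^ (K + 1)
                    + ∑ k ∈ Finset.Icc 1 ν, |(bernoulli (2 * k) : ℝ) / (2 * k)| * 2 ^ (K + 1 + 4 * k)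
                        * (1 / (4 * (π * m₀ / a / 2))) ^ (K + 1)) / 2
                  + (∑' k : ℕ, Real.exp (-(2 * a * digammaNode k)) * digammaNode k ^ (2 * R + 1))
                      / |π * m₀ / a| ^ (2 * R + 2))
                  + |(a ^ (q - k) + (-a) ^ (q - k)) * (I ^ (k + 1)).im| *
                    ((4 * Real.pi ^ 2 / 3 * ((2 * ν + 1).factorial : ℝ) / (2 * Real.pi) ^ (2 * ν + 1)
                      * (4 * (1 / (4 * (π * m₀ / a / 2)))) ^ (2 * ν)
                    + (1 / (4 * (π * m₀ / a / 2))) ^ (K + 1) / ((K + 1) * (1 - 1 / (4 * (π * m₀ / a / 2))))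
                    + 2 * (1 / (4 * (π * m₀ / a / 2))) ^ (K + 1)
                    + ∑ k ∈ Finset.Icc 1 ν, |(bernoulli (2 * k) : ℝ) / (2 * k)| * 2 ^ (K + 1 + 4 * k)
                        * (1 / (4 * (π * m₀ / a / 2))) ^ (K + 1)) / 2
                  + (∑' k : ℕ, Real.exp (-(2 * a * digammaNode k)) * digammaNode k ^ (2 * R))
                      / |π * m₀ / a| ^ (2 * R + 1)) ) )) q)
    ∧ -- himge (J' = the images' polar depth)
    (∀ m, m₀ ≤ m → ∀ q ∈ se,
      |(weilWindowSesq a ((Icc (-a) a).indicator fun x : ℝ ↦ ((x : ℂ)) ^ q) (chi a m)).re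
        - (-1 : ℝ) ^ m * ∑ f : Fin 4 × Fin D,
            (fun (q : ℕ) (x : Fin 4 × Fin D) ↦ (1 / Real.sqrt (2 * a)) * ((![fun dd : ℕ ↦ (∑ r ∈ (Finset.range J').filter (fun r ↦ 2 * r + 2 = dd), (4 * (∫ x in (-a)..a, x ^ q * Real.cosh (x / 2)) * (Real.exp (a / 2) - Real.exp (-(a / 2)))) * (fun r : ℕ ↦ (-1 : ℝ) ^ r * (a ^ 2 / (4 * π ^ 2)) ^ (r + 1)) r)
                + (∑ k ∈ (Finset.range (q + 1)).filter (fun k ↦ k + 1 = dd),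
                    ((fun k : ℕ ↦ (-1 : ℝ) ^ k * (q.descFactorial k : ℝ) * (a / π) ^ (k + 1)) k * (fun k : ℕ ↦ (I ^ (k + 1) *
                      ((∑ n ∈ weilPrimeIndex a, ((Λ n : ℝ) / Real.sqrt n : ℂ) *
                          (((a : ℂ)) ^ (q - k) - (((-a : ℝ)) : ℂ) ^ (q - k)
                            + (((a : ℂ)) ^ (q - k) - (((a - Real.log n : ℝ)) : ℂ) ^ (q - k))
                            + ((((-a + Real.log n : ℝ)) : ℂ) ^ (q - k) - (((-a : ℝ)) : ℂ) ^ (q - k))))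
                        + ((∫ t in Ioc 0 (2 * a), weilArchDensity t *
                            ((a ^ (q - k) - (a - t) ^ (q - k)) + ((-a + t) ^ (q - k) - (-a) ^ (q - k))) : ℝ) : ℂ)
                        + (2 * ((∫ t in Ioi (2 * a), weilArchDensity t : ℝ) : ℂ) - (weilMarkovConstant a : ℂ))
                            * (((a : ℂ)) ^ (q - k) - (((-a : ℝ)) : ℂ) ^ (q - k)))).re) k
                      + (fun k : ℕ ↦ (-1 : ℝ) ^ k * (q.descFactorial k : ℝ) * (a / π) ^ (k + 1)) k * (fun k : ℕ ↦ (a ^ (q - k) - (-a) ^ (q - k)) * (I ^ (k + 1)).re) k * (Real.log (π / (2 * a)) / 2 - reDigammaQuarter 0 / 2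
                            - ∑' l : ℕ, Real.exp (-(2 * a * digammaNode l)) / digammaNode l)
                      + (fun k : ℕ ↦ (-1 : ℝ) ^ k * (q.descFactorial k : ℝ) * (a / π) ^ (k + 1)) k * (fun k : ℕ ↦ (a ^ (q - k) + (-a) ^ (q - k)) * (I ^ (k + 1)).im) k * (π / 4)))
                + (∑ x ∈ (Finset.range (q + 1) ×ˢ Finset.Icc 1 K).filter (fun x ↦ x.1 + 1 + x.2 = dd),
                    (fun k : ℕ ↦ (-1 : ℝ) ^ k * (q.descFactorial k : ℝ) * (a / π) ^ (k + 1)) x.1 * (fun k : ℕ ↦ (a ^ (q - k) - (-a) ^ (q - k)) * (I ^ (k + 1)).re) x.1 * (fun N : ℕ ↦ (if N % 4 = 0 then (1 : ℝ) else if N % 4 = 2 then -1 else 0)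
                            * (1 - 1 / (2 * (N : ℝ))
                                - (∑ l ∈ Finset.Icc 1 ν, (bernoulli (2 * l) : ℝ) / (2 * l) * 16 ^ l
                                    * (((N - 1).choose (2 * l - 1) : ℕ) : ℝ)) / 2)
                            * (a / (2 * π)) ^ N) x.2)
                + (∑ x ∈ (Finset.range (q + 1) ×ˢ Finset.range R).filter (fun x ↦ x.1 + 1 + (2 * x.2 + 2) = dd),
                    (fun k : ℕ ↦ (-1 : ℝ) ^ k * (q.descFactorial k : ℝ) * (a / π) ^ (k + 1)) x.1 * (fun k : ℕ ↦ (a ^ (q - k) - (-a) ^ (q - k)) * (I ^ (k + 1)).re) x.1 * (fun r : ℕ ↦ (-1 : ℝ) ^ r *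
                            (∑' l : ℕ, Real.exp (-(2 * a * digammaNode l)) * digammaNode l ^ (2 * r + 1))
                            * (a / π) ^ (2 * r + 2)) x.2)
                + (∑ x ∈ (Finset.range (q + 1) ×ˢ Finset.Icc 1 K).filter (fun x ↦ x.1 + 1 + x.2 = dd),
                    (fun k : ℕ ↦ (-1 : ℝ) ^ k * (q.descFactorial k : ℝ) * (a / π) ^ (k + 1)) x.1 * (fun k : ℕ ↦ (a ^ (q - k) + (-a) ^ (q - k)) * (I ^ (k + 1)).im) x.1 * (fun N : ℕ ↦ (if N % 4 = 1 then (1 : ℝ) else if N % 4 = 3 then -1 else 0)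
                            * (1 - 1 / (2 * (N : ℝ))
                                - (∑ l ∈ Finset.Icc 1 ν, (bernoulli (2 * l) : ℝ) / (2 * l) * 16 ^ l
                                    * (((N - 1).choose (2 * l - 1) : ℕ) : ℝ)) / 2)
                            * (a / (2 * π)) ^ N) x.2)
                - (∑ x ∈ (Finset.range (q + 1) ×ˢ Finset.range R).filter (fun x ↦ x.1 + 1 + (2 * x.2 + 1) = dd),
                    (fun k : ℕ ↦ (-1 : ℝ) ^ k * (q.descFactorial k : ℝ) * (a / π) ^ (k + 1)) x.1 * (fun k : ℕ ↦ (a ^ (q - k) + (-a) ^ (q - k)) * (I ^ (k + 1)).im) x.1 * (fun r : ℕ ↦ (-1 : ℝ) ^ r *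
                            (∑' l : ℕ, Real.exp (-(2 * a * digammaNode l)) * digammaNode l ^ (2 * r))
                            * (a / π) ^ (2 * r + 1)) x.2),
                fun dd : ℕ ↦ ∑ k ∈ (Finset.range (q + 1)).filter (fun k ↦ k + 1 = dd), (fun k : ℕ ↦ (-1 : ℝ) ^ k * (q.descFactorial k : ℝ) * (a / π) ^ (k + 1)) k * (fun k : ℕ ↦ (a ^ (q - k) - (-a) ^ (q - k)) * (I ^ (k + 1)).re) k / 2,
                fun dd : ℕ ↦ ∑ k ∈ (Finset.range (q + 1)).filter (fun k ↦ k + 1 = dd), (fun k : ℕ ↦ (-1 : ℝ) ^ k * (q.descFactorial k : ℝ) * (a / π) ^ (k + 1)) k * (fun k : ℕ ↦ (a ^ (q - k) - (-a) ^ (q - k)) * (I ^ (k + 1)).re) k,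
                fun dd : ℕ ↦ ∑ k ∈ (Finset.range (q + 1)).filter (fun k ↦ k + 1 = dd), (fun k : ℕ ↦ (-1 : ℝ) ^ k * (q.descFactorial k : ℝ) * (a / π) ^ (k + 1)) k * (fun k : ℕ ↦ (a ^ (q - k) + (-a) ^ (q - k)) * (I ^ (k + 1)).im) k] x.1) ((x.2 : ℕ) + 1)) / (m₀ : ℝ) ^ ((x.2 : ℕ) + 1)) q f
            * (fun (x : Fin 4 × Fin D) (m : ℕ) ↦ ![(1 : ℝ), Real.log m, -(∑ n ∈ weilPrimeIndex a, (Λ n : ℝ) / Real.sqrt n * Real.cos (π * m / a * Real.log n)), (∑ n ∈ weilPrimeIndex a, (Λ n : ℝ) / Real.sqrt n * Real.sin (π * m / a * Real.log n))] x.1 * ((m₀ : ℝ) / (m : ℝ)) ^ ((x.2 : ℕ) + 1)) f m|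
        ≤ (fun q : ℕ ↦ (1 / Real.sqrt (2 * a)) * ( |(4 * (∫ x in (-a)..a, x ^ q * Real.cosh (x / 2)) * (Real.exp (a / 2) - Real.exp (-(a / 2))))|
              * ((a ^ 2 / (4 * π ^ 2)) ^ (J' + 1) / (m₀ : ℝ) ^ (2 * J' + 2))
            + ∑ k ∈ Finset.range (q + 1), (q.descFactorial k : ℝ) * (a / (π * m₀)) ^ (k + 1) *
                ( |(a ^ (q - k) - (-a) ^ (q - k)) * (I ^ (k + 1)).re| *
                    ((4 * Real.pi ^ 2 / 3 * ((2 * ν + 1).factorial : ℝ) / (2 * Real.pi) ^ (2 * ν + 1)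
                      * (4 * (1 / (4 * (π * m₀ / a / 2)))) ^ (2 * ν)
                    + (1 / (4 * (π * m₀ / a / 2))) ^ (K + 1) / ((K + 1) * (1 - 1 / (4 * (π * m₀ / a / 2))))
                    + 2 * (1 / (4 * (π * m₀ / a / 2))) ^ (K + 1)
                    + ∑ k ∈ Finset.Icc 1 ν, |(bernoulli (2 * k) : ℝ) / (2 * k)| * 2 ^ (K + 1 + 4 * k)
                        * (1 / (4 * (π * m₀ / a / 2))) ^ (K + 1)) / 2
                  + (∑' k : ℕ, Real.exp (-(2 * a * digammaNode k)) * digammaNode k ^ (2 * R + 1))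
                      / |π * m₀ / a| ^ (2 * R + 2))
                  + |(a ^ (q - k) + (-a) ^ (q - k)) * (I ^ (k + 1)).im| *
                    ((4 * Real.pi ^ 2 / 3 * ((2 * ν + 1).factorial : ℝ) / (2 * Real.pi) ^ (2 * ν + 1)
                      * (4 * (1 / (4 * (π * m₀ / a / 2)))) ^ (2 * ν)
                    + (1 / (4 * (π * m₀ / a / 2))) ^ (K + 1) / ((K + 1) * (1 - 1 / (4 * (π * m₀ / a / 2))))
                    + 2 * (1 / (4 * (π * m₀ / a / 2))) ^ (K + 1)
                    + ∑ k ∈ Finset.Icc 1 ν, |(bernoulli (2 * k) : ℝ) / (2 * k)| * 2 ^ (K + 1 + 4 * k)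
                        * (1 / (4 * (π * m₀ / a / 2))) ^ (K + 1)) / 2
                  + (∑' k : ℕ, Real.exp (-(2 * a * digammaNode k)) * digammaNode k ^ (2 * R))
                      / |π * m₀ / a| ^ (2 * R + 1)) ) )) q
          * (fun m : ℕ ↦ ((m₀ : ℝ) / m) ^ (E + 1)) m)
    ∧ -- hV
    (∀ m, m₀ ≤ m → ∀ j : Fin re,
      (if m = 0 then (1 : ℝ) else 2) * (Yoshida1992.fourierCoeff a m
          ((Icc (-a) a).indicator fun x : ℝ ↦ ∑ q ∈ se, ((coefe j q : ℝ) : ℂ) * ((x : ℂ)) ^ q)).re / Real.sqrt (2 * a)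
        = (-1 : ℝ) ^ m * ∑ f : Fin 4 × Fin D, (fun (j : Fin re) (x : Fin 4 × Fin D) ↦ ((![fun d : ℕ ↦ ∑ p ∈ (se.sigma fun q ↦ Finset.range (q + 1)).filter (fun p ↦ p.2 + 1 = d),
              2 * coefe j p.1 * ((-1 : ℝ) ^ p.2 * (p.1.descFactorial p.2 : ℝ) * (a ^ (p.1 - p.2) - (-a) ^ (p.1 - p.2))
                * (a / π) ^ (p.2 + 1) * (I ^ (p.2 + 1)).re) / Real.sqrt (2 * a),
              fun _ ↦ 0, fun _ ↦ 0, fun _ ↦ 0] x.1) ((x.2 : ℕ) + 1) / (m₀ : ℝ) ^ ((x.2 : ℕ) + 1))) j f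
            * (fun (x : Fin 4 × Fin D) (m : ℕ) ↦ ![(1 : ℝ), Real.log m, -(∑ n ∈ weilPrimeIndex a, (Λ n : ℝ) / Real.sqrt n * Real.cos (π * m / a * Real.log n)), (∑ n ∈ weilPrimeIndex a, (Λ n : ℝ) / Real.sqrt n * Real.sin (π * m / a * Real.log n))] x.1 * ((m₀ : ℝ) / (m : ℝ)) ^ ((x.2 : ℕ) + 1)) f m)
    ∧ -- hW
    (∀ N, ∑ m ∈ Ico m₀ N, ((fun m : ℕ ↦ ((m₀ : ℝ) / m) ^ (E + 1)) m) ^ 2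
        ≤ (m₀ : ℝ) ^ (2 * E + 2) / ((2 * E + 1 : ℝ) * (((m₀ - 1 : ℕ) : ℝ)) ^ (2 * E + 1))) := by
  have hm₀r : (m₀ : ℝ) ≠ 0 := by
    have : (0 : ℝ) < m₀ := by exact_mod_cast (show 0 < m₀ by omega)
    exact this.ne'
  refine ⟨fun n ↦ evenRow_remainder_nonneg ha hm₀ n ν K R J, fun m hm n hn ↦ ?_,
    fun q ↦ re_image_remainder_nonneg ha hm₀ q ν K R J', fun m hm q hq ↦ ?_, fun m hm j ↦ ?_, fun N ↦ ?_⟩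
  · -- hrowe (rescaled): family lemma, then `cinf_collected_rescale`
    have h := abs_evenRow_sub_family_le ha hm₀ hm (i := n) (by omega) hν hK (R := R) (J := J) hE1 hE2 hE3 hEJ hD1 hD2
    beta_reduce
    exact cinf_collected_rescale (fun t d ↦ (![fun d : ℕ ↦ (∑ j ∈ (Finset.range J).filter (fun j ↦ (2 * j + 1) = d),
                π / 4 * ((-1 : ℝ) ^ n * (n : ℝ) ^ (2 * j)) / Real.pi)
              + (∑ p ∈ (Finset.Icc 1 K ×ˢ Finset.range J).filter (fun p ↦ p.1 + (2 * p.2 + 1) = d),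
                  (fun N : ℕ ↦ (if N % 4 = 1 then (1 : ℝ) else if N % 4 = 3 then -1 else 0)
              * (1 - 1 / (2 * (N : ℝ))
                  - (∑ l ∈ Finset.Icc 1 ν, (bernoulli (2 * l) : ℝ) / (2 * l) * 16 ^ l
                      * (((N - 1).choose (2 * l - 1) : ℕ) : ℝ)) / 2)
              * (a / (2 * π)) ^ N) p.1
                    * ((-1 : ℝ) ^ n * (n : ℝ) ^ (2 * p.2)) / Real.pi)
              - (∑ p ∈ (Finset.range R ×ˢ Finset.range J).filter (fun p ↦ (2 * p.1 + 1) + (2 * p.2 + 1) = d),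
                  (fun r : ℕ ↦ (-1 : ℝ) ^ r *
              (∑' l : ℕ, Real.exp (-(2 * a * digammaNode l)) * digammaNode l ^ (2 * r)) * (a / π) ^ (2 * r + 1)) p.1
                    * ((-1 : ℝ) ^ n * (n : ℝ) ^ (2 * p.2)) / Real.pi)
              + (∑ r ∈ (Finset.range J).filter (fun r ↦ (2 * r + 2) = d),
                  (fun r : ℕ ↦ (-1 : ℝ) ^ n *
              (-((n : ℝ) ^ (2 * r + 1)) * ((Complex.digamma (1 / 4 + ((freq a n : ℝ) : ℂ) / 2 * I)).im / 2
                  + (∑ k ∈ weilPrimeIndex a, (Λ k : ℝ) / Real.sqrt k * Real.sin (freq a n * Real.log k))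
                  - archExpSumSin a n) / π
                + 4 / a * (Real.exp (a / 2) - Real.exp (-(a / 2))) ^ 2 * (-1 : ℝ) ^ r * (a ^ 2 / (4 * π ^ 2)) ^ (r + 1)
                  * (1 / (1 + 4 * freq a n ^ 2)))) r),
                fun _ ↦ 0, fun _ ↦ 0,
                fun d : ℕ ↦ ∑ j ∈ (Finset.range J).filter (fun j ↦ (2 * j + 1) = d),
                ((-1 : ℝ) ^ n * (n : ℝ) ^ (2 * j)) / Real.pi] t) d) (fun t ↦ by fin_cases t <;> simp) (![(1 : ℝ), Real.log m, -(∑ n ∈ weilPrimeIndex a, (Λ n : ℝ) / Real.sqrt n * Real.cos (π * m / a * Real.log n)), (∑ n ∈ weilPrimeIndex a, (Λ n : ℝ) / Real.sqrt n * Real.sin (π * m / a * Real.log n))]) (m : ℝ) hm₀r D h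
  · -- himge (rescaled): family lemma, scale (2a)^(-1/2) into the coefficients, then rescale
    have h := abs_sub_collected_scale _ (1 / Real.sqrt (2 * a)) ((-1 : ℝ) ^ m) _ _
      (fun x : Fin 4 × Fin (D + 1) ↦ (![fun dd : ℕ ↦ (∑ r ∈ (Finset.range J').filter (fun r ↦ 2 * r + 2 = dd), (4 * (∫ x in (-a)..a, x ^ q * Real.cosh (x / 2)) * (Real.exp (a / 2) - Real.exp (-(a / 2)))) * (fun r : ℕ ↦ (-1 : ℝ) ^ r * (a ^ 2 / (4 * π ^ 2)) ^ (r + 1)) r)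
                + (∑ k ∈ (Finset.range (q + 1)).filter (fun k ↦ k + 1 = dd),
                    ((fun k : ℕ ↦ (-1 : ℝ) ^ k * (q.descFactorial k : ℝ) * (a / π) ^ (k + 1)) k * (fun k : ℕ ↦ (I ^ (k + 1) *
                      ((∑ n ∈ weilPrimeIndex a, ((Λ n : ℝ) / Real.sqrt n : ℂ) *
                          (((a : ℂ)) ^ (q - k) - (((-a : ℝ)) : ℂ) ^ (q - k)
                            + (((a : ℂ)) ^ (q - k) - (((a - Real.log n : ℝ)) : ℂ) ^ (q - k))
                            + ((((-a + Real.log n : ℝ)) : ℂ) ^ (q - k) - (((-a : ℝ)) : ℂ) ^ (q - k))))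
                        + ((∫ t in Ioc 0 (2 * a), weilArchDensity t *
                            ((a ^ (q - k) - (a - t) ^ (q - k)) + ((-a + t) ^ (q - k) - (-a) ^ (q - k))) : ℝ) : ℂ)
                        + (2 * ((∫ t in Ioi (2 * a), weilArchDensity t : ℝ) : ℂ) - (weilMarkovConstant a : ℂ))
                            * (((a : ℂ)) ^ (q - k) - (((-a : ℝ)) : ℂ) ^ (q - k)))).re) k
                      + (fun k : ℕ ↦ (-1 : ℝ) ^ k * (q.descFactorial k : ℝ) * (a / π) ^ (k + 1)) k * (fun k : ℕ ↦ (a ^ (q - k) - (-a) ^ (q - k)) * (I ^ (k + 1)).re) k * (Real.log (π / (2 * a)) / 2 - reDigammaQuarter 0 / 2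
                            - ∑' l : ℕ, Real.exp (-(2 * a * digammaNode l)) / digammaNode l)
                      + (fun k : ℕ ↦ (-1 : ℝ) ^ k * (q.descFactorial k : ℝ) * (a / π) ^ (k + 1)) k * (fun k : ℕ ↦ (a ^ (q - k) + (-a) ^ (q - k)) * (I ^ (k + 1)).im) k * (π / 4)))
                + (∑ x ∈ (Finset.range (q + 1) ×ˢ Finset.Icc 1 K).filter (fun x ↦ x.1 + 1 + x.2 = dd),
                    (fun k : ℕ ↦ (-1 : ℝ) ^ k * (q.descFactorial k : ℝ) * (a / π) ^ (k + 1)) x.1 * (fun k : ℕ ↦ (a ^ (q - k) - (-a) ^ (q - k)) * (I ^ (k + 1)).re) x.1 * (fun N : ℕ ↦ (if N % 4 = 0 then (1 : ℝ) else if N % 4 = 2 then -1 else 0)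
                            * (1 - 1 / (2 * (N : ℝ))
                                - (∑ l ∈ Finset.Icc 1 ν, (bernoulli (2 * l) : ℝ) / (2 * l) * 16 ^ l
                                    * (((N - 1).choose (2 * l - 1) : ℕ) : ℝ)) / 2)
                            * (a / (2 * π)) ^ N) x.2)
                + (∑ x ∈ (Finset.range (q + 1) ×ˢ Finset.range R).filter (fun x ↦ x.1 + 1 + (2 * x.2 + 2) = dd),
                    (fun k : ℕ ↦ (-1 : ℝ) ^ k * (q.descFactorial k : ℝ) * (a / π) ^ (k + 1)) x.1 * (fun k : ℕ ↦ (a ^ (q - k) - (-a) ^ (q - k)) * (I ^ (k + 1)).re) x.1 * (fun r : ℕ ↦ (-1 : ℝ) ^ r *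
                            (∑' l : ℕ, Real.exp (-(2 * a * digammaNode l)) * digammaNode l ^ (2 * r + 1))
                            * (a / π) ^ (2 * r + 2)) x.2)
                + (∑ x ∈ (Finset.range (q + 1) ×ˢ Finset.Icc 1 K).filter (fun x ↦ x.1 + 1 + x.2 = dd),
                    (fun k : ℕ ↦ (-1 : ℝ) ^ k * (q.descFactorial k : ℝ) * (a / π) ^ (k + 1)) x.1 * (fun k : ℕ ↦ (a ^ (q - k) + (-a) ^ (q - k)) * (I ^ (k + 1)).im) x.1 * (fun N : ℕ ↦ (if N % 4 = 1 then (1 : ℝ) else if N % 4 = 3 then -1 else 0)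
                            * (1 - 1 / (2 * (N : ℝ))
                                - (∑ l ∈ Finset.Icc 1 ν, (bernoulli (2 * l) : ℝ) / (2 * l) * 16 ^ l
                                    * (((N - 1).choose (2 * l - 1) : ℕ) : ℝ)) / 2)
                            * (a / (2 * π)) ^ N) x.2)
                - (∑ x ∈ (Finset.range (q + 1) ×ˢ Finset.range R).filter (fun x ↦ x.1 + 1 + (2 * x.2 + 1) = dd),
                    (fun k : ℕ ↦ (-1 : ℝ) ^ k * (q.descFactorial k : ℝ) * (a / π) ^ (k + 1)) x.1 * (fun k : ℕ ↦ (a ^ (q - k) + (-a) ^ (q - k)) * (I ^ (k + 1)).im) x.1 * (fun r : ℕ ↦ (-1 : ℝ) ^ r *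
                            (∑' l : ℕ, Real.exp (-(2 * a * digammaNode l)) * digammaNode l ^ (2 * r))
                            * (a / π) ^ (2 * r + 1)) x.2),
                fun dd : ℕ ↦ ∑ k ∈ (Finset.range (q + 1)).filter (fun k ↦ k + 1 = dd), (fun k : ℕ ↦ (-1 : ℝ) ^ k * (q.descFactorial k : ℝ) * (a / π) ^ (k + 1)) k * (fun k : ℕ ↦ (a ^ (q - k) - (-a) ^ (q - k)) * (I ^ (k + 1)).re) k / 2,
                fun dd : ℕ ↦ ∑ k ∈ (Finset.range (q + 1)).filter (fun k ↦ k + 1 = dd), (fun k : ℕ ↦ (-1 : ℝ) ^ k * (q.descFactorial k : ℝ) * (a / π) ^ (k + 1)) k * (fun k : ℕ ↦ (a ^ (q - k) - (-a) ^ (q - k)) * (I ^ (k + 1)).re) k,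
                fun dd : ℕ ↦ ∑ k ∈ (Finset.range (q + 1)).filter (fun k ↦ k + 1 = dd), (fun k : ℕ ↦ (-1 : ℝ) ^ k * (q.descFactorial k : ℝ) * (a / π) ^ (k + 1)) k * (fun k : ℕ ↦ (a ^ (q - k) + (-a) ^ (q - k)) * (I ^ (k + 1)).im) k] x.1) x.2)
      (fun x : Fin 4 × Fin (D + 1) ↦ ![(1 : ℝ), Real.log m, -(∑ n ∈ weilPrimeIndex a, (Λ n : ℝ) / Real.sqrt n * Real.cos (π * m / a * Real.log n)), (∑ n ∈ weilPrimeIndex a, (Λ n : ℝ) / Real.sqrt n * Real.sin (π * m / a * Real.log n))] x.1 / (m : ℝ) ^ (x.2 : ℕ))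
      (abs_re_image_pow_sub_family_le ha hm₀ hm q hν hK (R := R) (J := J') hE1 hE2 hE3 hEJ' hDJ' (hDK q hq) (hDR q hq))
    beta_reduce at h
    beta_reduce
    exact cinf_collected_rescale (fun t d ↦ (1 / Real.sqrt (2 * a)) * ((![fun dd : ℕ ↦ (∑ r ∈ (Finset.range J').filter (fun r ↦ 2 * r + 2 = dd), (4 * (∫ x in (-a)..a, x ^ q * Real.cosh (x / 2)) * (Real.exp (a / 2) - Real.exp (-(a / 2)))) * (fun r : ℕ ↦ (-1 : ℝ) ^ r * (a ^ 2 / (4 * π ^ 2)) ^ (r + 1)) r)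
                + (∑ k ∈ (Finset.range (q + 1)).filter (fun k ↦ k + 1 = dd),
                    ((fun k : ℕ ↦ (-1 : ℝ) ^ k * (q.descFactorial k : ℝ) * (a / π) ^ (k + 1)) k * (fun k : ℕ ↦ (I ^ (k + 1) *
                      ((∑ n ∈ weilPrimeIndex a, ((Λ n : ℝ) / Real.sqrt n : ℂ) *
                          (((a : ℂ)) ^ (q - k) - (((-a : ℝ)) : ℂ) ^ (q - k)
                            + (((a : ℂ)) ^ (q - k) - (((a - Real.log n : ℝ)) : ℂ) ^ (q - k))
                            + ((((-a + Real.log n : ℝ)) : ℂ) ^ (q - k) - (((-a : ℝ)) : ℂ) ^ (q - k))))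
                        + ((∫ t in Ioc 0 (2 * a), weilArchDensity t *
                            ((a ^ (q - k) - (a - t) ^ (q - k)) + ((-a + t) ^ (q - k) - (-a) ^ (q - k))) : ℝ) : ℂ)
                        + (2 * ((∫ t in Ioi (2 * a), weilArchDensity t : ℝ) : ℂ) - (weilMarkovConstant a : ℂ))
                            * (((a : ℂ)) ^ (q - k) - (((-a : ℝ)) : ℂ) ^ (q - k)))).re) k
                      + (fun k : ℕ ↦ (-1 : ℝ) ^ k * (q.descFactorial k : ℝ) * (a / π) ^ (k + 1)) k * (fun k : ℕ ↦ (a ^ (q - k) - (-a) ^ (q - k)) * (I ^ (k + 1)).re) k * (Real.log (π / (2 * a)) / 2 - reDigammaQuarter 0 / 2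
                            - ∑' l : ℕ, Real.exp (-(2 * a * digammaNode l)) / digammaNode l)
                      + (fun k : ℕ ↦ (-1 : ℝ) ^ k * (q.descFactorial k : ℝ) * (a / π) ^ (k + 1)) k * (fun k : ℕ ↦ (a ^ (q - k) + (-a) ^ (q - k)) * (I ^ (k + 1)).im) k * (π / 4)))
                + (∑ x ∈ (Finset.range (q + 1) ×ˢ Finset.Icc 1 K).filter (fun x ↦ x.1 + 1 + x.2 = dd),
                    (fun k : ℕ ↦ (-1 : ℝ) ^ k * (q.descFactorial k : ℝ) * (a / π) ^ (k + 1)) x.1 * (fun k : ℕ ↦ (a ^ (q - k) - (-a) ^ (q - k)) * (I ^ (k + 1)).re) x.1 * (fun N : ℕ ↦ (if N % 4 = 0 then (1 : ℝ) else if N % 4 = 2 then -1 else 0)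
                            * (1 - 1 / (2 * (N : ℝ))
                                - (∑ l ∈ Finset.Icc 1 ν, (bernoulli (2 * l) : ℝ) / (2 * l) * 16 ^ l
                                    * (((N - 1).choose (2 * l - 1) : ℕ) : ℝ)) / 2)
                            * (a / (2 * π)) ^ N) x.2)
                + (∑ x ∈ (Finset.range (q + 1) ×ˢ Finset.range R).filter (fun x ↦ x.1 + 1 + (2 * x.2 + 2) = dd),
                    (fun k : ℕ ↦ (-1 : ℝ) ^ k * (q.descFactorial k : ℝ) * (a / π) ^ (k + 1)) x.1 * (fun k : ℕ ↦ (a ^ (q - k) - (-a) ^ (q - k)) * (I ^ (k + 1)).re) x.1 * (fun r : ℕ ↦ (-1 : ℝ) ^ r *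
                            (∑' l : ℕ, Real.exp (-(2 * a * digammaNode l)) * digammaNode l ^ (2 * r + 1))
                            * (a / π) ^ (2 * r + 2)) x.2)
                + (∑ x ∈ (Finset.range (q + 1) ×ˢ Finset.Icc 1 K).filter (fun x ↦ x.1 + 1 + x.2 = dd),
                    (fun k : ℕ ↦ (-1 : ℝ) ^ k * (q.descFactorial k : ℝ) * (a / π) ^ (k + 1)) x.1 * (fun k : ℕ ↦ (a ^ (q - k) + (-a) ^ (q - k)) * (I ^ (k + 1)).im) x.1 * (fun N : ℕ ↦ (if N % 4 = 1 then (1 : ℝ) else if N % 4 = 3 then -1 else 0)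
                            * (1 - 1 / (2 * (N : ℝ))
                                - (∑ l ∈ Finset.Icc 1 ν, (bernoulli (2 * l) : ℝ) / (2 * l) * 16 ^ l
                                    * (((N - 1).choose (2 * l - 1) : ℕ) : ℝ)) / 2)
                            * (a / (2 * π)) ^ N) x.2)
                - (∑ x ∈ (Finset.range (q + 1) ×ˢ Finset.range R).filter (fun x ↦ x.1 + 1 + (2 * x.2 + 1) = dd),
                    (fun k : ℕ ↦ (-1 : ℝ) ^ k * (q.descFactorial k : ℝ) * (a / π) ^ (k + 1)) x.1 * (fun k : ℕ ↦ (a ^ (q - k) + (-a) ^ (q - k)) * (I ^ (k + 1)).im) x.1 * (fun r : ℕ ↦ (-1 : ℝ) ^ r *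
                            (∑' l : ℕ, Real.exp (-(2 * a * digammaNode l)) * digammaNode l ^ (2 * r))
                            * (a / π) ^ (2 * r + 1)) x.2),
                fun dd : ℕ ↦ ∑ k ∈ (Finset.range (q + 1)).filter (fun k ↦ k + 1 = dd), (fun k : ℕ ↦ (-1 : ℝ) ^ k * (q.descFactorial k : ℝ) * (a / π) ^ (k + 1)) k * (fun k : ℕ ↦ (a ^ (q - k) - (-a) ^ (q - k)) * (I ^ (k + 1)).re) k / 2,
                fun dd : ℕ ↦ ∑ k ∈ (Finset.range (q + 1)).filter (fun k ↦ k + 1 = dd), (fun k : ℕ ↦ (-1 : ℝ) ^ k * (q.descFactorial k : ℝ) * (a / π) ^ (k + 1)) k * (fun k : ℕ ↦ (a ^ (q - k) - (-a) ^ (q - k)) * (I ^ (k + 1)).re) k,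
                fun dd : ℕ ↦ ∑ k ∈ (Finset.range (q + 1)).filter (fun k ↦ k + 1 = dd), (fun k : ℕ ↦ (-1 : ℝ) ^ k * (q.descFactorial k : ℝ) * (a / π) ^ (k + 1)) k * (fun k : ℕ ↦ (a ^ (q - k) + (-a) ^ (q - k)) * (I ^ (k + 1)).im) k] t) d)) (fun t ↦ by fin_cases t <;> simp)
      (![(1 : ℝ), Real.log m, -(∑ n ∈ weilPrimeIndex a, (Λ n : ℝ) / Real.sqrt n * Real.cos (π * m / a * Real.log n)), (∑ n ∈ weilPrimeIndex a, (Λ n : ℝ) / Real.sqrt n * Real.sin (π * m / a * Real.log n))]) (m : ℝ) hm₀r D h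
  · -- hVe (rescaled, an identity)
    have h := evenVTable_family ha (m := m) (by omega) se (coefe j) hDq
    beta_reduce
    exact cinf_collected_rescale_eq (fun t d ↦ (![fun d : ℕ ↦ ∑ p ∈ (se.sigma fun q ↦ Finset.range (q + 1)).filter (fun p ↦ p.2 + 1 = d),
              2 * coefe j p.1 * ((-1 : ℝ) ^ p.2 * (p.1.descFactorial p.2 : ℝ) * (a ^ (p.1 - p.2) - (-a) ^ (p.1 - p.2))
                * (a / π) ^ (p.2 + 1) * (I ^ (p.2 + 1)).re) / Real.sqrt (2 * a),
              fun _ ↦ 0, fun _ ↦ 0, fun _ ↦ 0] t) d) (fun t ↦ by fin_cases t <;> simp) (![(1 : ℝ), Real.log m, -(∑ n ∈ weilPrimeIndex a, (Λ n : ℝ) / Real.sqrt n * Real.cos (π * m / a * Real.log n)), (∑ n ∈ weilPrimeIndex a, (Λ n : ℝ) / Real.sqrt n * Real.sin (π * m / a * Real.log n))]) (m : ℝ) hm₀r D h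
  · exact sum_Ico_weight_sq_le hm₀2 E N

end Summit.RiemannHypothesis.RiemannHypothesis.Theorems.WeilFormatC

end
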